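import Mathlib.Analysis.Complex.LocallyUniformLimit
import Mathlib.Analysis.SpecialFunctions.ExpDeriv
import Mathlib.Analysis.SpecialFunctions.Log.Basic
import Mathlib.Analysis.SpecialFunctions.Trigonometric.Basic
import Mathlib.Analysis.SpecificLimits.Normed
import Mathlib.Analysis.Analytic.Constructions
import Mathlib.Topology.Algebra.InfiniteSum.NatInt
import Mathlib.Topology.Algebra.InfiniteSum.Order
import Mathlib.Tactic.LinearCombination
import Mathlib.Tactic.Push
import Literature.Analysis.FluidPDE.KolmogorovFlowInstability

/-!
# Proof of Friedlander–Strauss–Vishik 1997, Proposition 5.1 (Kolmogorov flow is linearly unstable)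

This file discharges the named fact `Literature.Analysis.FluidPDE.friedlanderStraussVishik1997_prop51`
of `Literature/Analysis/FluidPDE/KolmogorovFlowInstability.lean`:
`theorem friedlanderStraussVishik1997_prop51_holds : friedlanderStraussVishik1997_prop51`.

**Statement proved.** For every integer `m > 1` there are `k = 1`, a real `σ > 0` (we get
`σ ∈ [1/4, 1]`) and a real-analytic `2π`-periodic `φ : ℝ → ℂ`, `φ ≢ 0`, solving the Rayleigh
equation `(σ + ik sin(my))(φ'' − k²φ) + ikm² sin(my) φ = 0` of the 2D Euler equations on `𝕋²`
linearised at the Kolmogorov flow `(sin(my), 0)` — an exponentially growing normal mode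
`φ(y)e^{ikx+σt}`.

**The printed proof (FSV 1997, §5, pp. 205–208) and how it is formalised here.** Following
Meshalkin–Sinai, FSV look for `φ = Σⱼ cⱼ e^{ijy}` (5.4); the Rayleigh equation (5.5) becomes the
three-term recurrence (5.6), which after the substitution `dⱼ = cⱼ(j² + k² − m²)` (5.8),
`aⱼ = 2σ(j² + k²)/(k(j² + k² − m²))` (5.7) reads `d_{j+m} − d_{j−m} = aⱼdⱼ` (5.9). Only the modes
`j ∈ mℤ` are used ("we define now `dⱼ = 0` for `j ≢ 0 (mod m)`"); we take `k = 1`, write `j = zm`,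
`M = m²`, `w_z = z²M + 1`, `e_z = (z² − 1)M + 1` (so `e₀ = 1 − M < 0 < 1 ≤ e_z` for `z ≠ 0`: on this
sublattice the denominators never vanish as soon as `0 < k < m`, which is why the Diophantine
hypothesis `m² ≠ m₁² + m₂²` of Prop. 5.1 — "assumed for simplicity" on p. 205 — is not needed and
is simply not used below; cf. Belenkaya–Friedlander–Yudovich 1999). The recurrence is
`d_{z+1} − d_{z−1} = A_z d_z`, `A_z = 2σ w_z/e_z`, with `A₀ < 0 < A_z` (`z ≠ 0`).

* §A (`cf_*`): the tails `uₙ(σ) = 1/[σβₙ; σβₙ₊₁, …]`, `βₙ = 2w_{n+1}/e_{n+1} ≥ 2` — FSV (5.10)–(5.15)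
  (`ρ_{pm} = −1/[a_{pm}, a_{(p+1)m}, …]`). As in the paper ("the continued fraction … is convergent
  … the partial denominators grow exponentially because the elements are positive and bounded away
  from zero"; "F(σ) … is continuous because the sequence of partial fractions is uniformly
  convergent on [ε, ∞)") we prove a two-step contraction of the truncations, uniform in `σ ≥ ε`,
  deduce convergence, the tail relation `uₙ = 1/(σβₙ + uₙ₊₁)` and continuity in `σ`
  (`TendstoUniformlyOn.continuousOn`). To stay definition-free the truncations `T` and limits `u`
  enter the lemmas through their defining equations (hypothesis `H`); they are constructed by
  `Nat.rec` / `limUnder` only inside the final proof.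
* §B (`exists_sigma`): the characteristic equation (5.19)/(5.20) `−a₀/2 = F(σ)`, here
  `u₀(σ) = σ/(M − 1)`, has a root: FSV compare the line with the bounds (5.22)
  `1/(a_m + 1/a_{2m}) < F < 1/a_m` (Fig. 2, (5.23)–(5.24)); we use the same upper bound at `σ = 1`
  and the lower bound `u₀ ≥ 1/(σβ₀ + 1/(2σ))` at `σ = 1/4`, then the intermediate value theorem.
* §C (`exists_d`): the sequence (5.21) `d₀ = 1`, `dₙ = (−1)ⁿu₀⋯uₙ₋₁`, `d₋ₙ = u₀⋯uₙ₋₁` solves (5.9)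
  (tail relation for `z ≠ 0`, characteristic equation for `z = 0`) and decays geometrically
  ((5.16)–(5.18); we use the pair bound `uₙuₙ₊₁ ≤ 1/(1 + 4σ²)` instead of the limit (5.17)).
* §D/§E: `c_z = d_z/e_z` decay geometrically, so `Φ(w) = Σ_z c_z e^{izmw}` converges on a strip
  `|Im w| < δ` and is holomorphic there with termwise derivatives
  (`Complex.differentiableOn_tsum_of_summable_norm`, `Complex.hasSum_deriv_of_summable_norm`);
  `φ = Φ|_ℝ` is real-analytic (`DifferentiableOn.analyticAt`, restriction of scalars, composition
  with `ofRealCLM`), `2π`-periodic, and the Rayleigh equation is the coefficient identity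
  `A_z d_z + d_{z−1} − d_{z+1} = 0` after writing `i sin(my) = (e^{imy} − e^{−imy})/2` and
  re-indexing the shifted series (`ode_algebra`; this is the computation (5.5) ⇔ (5.6)).
  `φ ≢ 0` because `φ'(0) = im Σ_z z c_z` and `Σ_z z c_z = Σ_{n≥1} n(dₙ − d₋ₙ)/eₙ < 0`.

## References

* S. Friedlander, W. Strauss, M. Vishik, *Nonlinear instability in an ideal fluid*, Ann. Inst.
  H. Poincaré Anal. Non Linéaire 14 (1997) 187–209, doi:10.1016/s0294-1449(97)80144-8, §5,
  Prop. 5.1 (p. 205), proof pp. 205–208 (held: paper:doi-10-1016-s0294-1449-97-80144-8).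
  [FriedlanderStraussVishik1997]
* L. D. Meshalkin, Ya. G. Sinai, J. Appl. Math. Mech. 25 (1961) 1700–1705 (the continued-fraction
  method, viscous case).
-/

noncomputable section

open Filter Complex
open scoped Topology

namespace Literature.Analysis.FluidPDE

namespace FriedlanderStraussVishik1997

/-! ### A. Tails of continued fractions with positive elements (FSV 1997, (5.14)–(5.18)) -/

/-- Elementary bound behind the convergence of the continued fractions: if `0 ≤ t ≤ 1/a'` then
`t/(a+t) ≤ 1/(1+aa')`. [folklore] -/
theorem cf_aux_pair {a a' t : ℝ} (ha : 0 < a) (ha' : 0 < a') (ht : 0 ≤ t) (hta : t ≤ 1 / a') :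
    1 / (a + t) * t ≤ 1 / (1 + a * a') := by
  rw [div_mul_eq_mul_div, one_mul, div_le_div_iff₀ (by positivity) (by positivity)]
  have h1 : t * a' ≤ 1 := by rwa [le_div_iff₀ ha'] at hta
  nlinarith [mul_le_mul_of_nonneg_left h1 ha.le]

/-- Two steps of the backward recursion `t ↦ 1/(a+t)`: an exact identity for the difference.
[folklore] -/
theorem cf_aux_two_step {a a' s₁ s₂ : ℝ} (ha : 0 < a) (ha' : 0 < a') (hs₁ : 0 ≤ s₁) (hs₂ : 0 ≤ s₂) :
    1 / (a + 1 / (a' + s₁)) - 1 / (a + 1 / (a' + s₂)) =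
      (s₁ - s₂) * ((1 / (a + 1 / (a' + s₁)) * (1 / (a' + s₁))) *
        (1 / (a + 1 / (a' + s₂)) * (1 / (a' + s₂)))) := by
  have h1 : a' + s₁ ≠ 0 := by positivity
  have h2 : a' + s₂ ≠ 0 := by positivity
  have h3 : a + 1 / (a' + s₁) ≠ 0 := by positivity
  have h4 : a + 1 / (a' + s₂) ≠ 0 := by positivity
  field_simp
  ring

/-- Two steps of the backward recursion contract by the factor `(1/(1+aa'))²`. [folklore] -/
theorem cf_aux_two_step_abs {a a' s₁ s₂ r : ℝ} (ha : 0 < a) (ha' : 0 < a') (hs₁ : 0 ≤ s₁)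
    (hs₂ : 0 ≤ s₂) (hr : 1 / (1 + a * a') ≤ r) :
    |1 / (a + 1 / (a' + s₁)) - 1 / (a + 1 / (a' + s₂))| ≤ r ^ 2 * |s₁ - s₂| := by
  rw [cf_aux_two_step ha ha' hs₁ hs₂, abs_mul]
  have ht₁ : 0 ≤ 1 / (a' + s₁) := by positivity
  have ht₂ : 0 ≤ 1 / (a' + s₂) := by positivity
  have ht₁' : 1 / (a' + s₁) ≤ 1 / a' := one_div_le_one_div_of_le ha' (le_add_of_nonneg_right hs₁)
  have ht₂' : 1 / (a' + s₂) ≤ 1 / a' := one_div_le_one_div_of_le ha' (le_add_of_nonneg_right hs₂)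
  have hB₁ := cf_aux_pair ha ha' ht₁ ht₁'
  have hB₂ := cf_aux_pair ha ha' ht₂ ht₂'
  have hB₁0 : 0 ≤ 1 / (a + 1 / (a' + s₁)) * (1 / (a' + s₁)) := by positivity
  have hB₂0 : 0 ≤ 1 / (a + 1 / (a' + s₂)) * (1 / (a' + s₂)) := by positivity
  have hr0 : 0 ≤ r := le_trans (by positivity) hr
  rw [abs_of_nonneg (mul_nonneg hB₁0 hB₂0), mul_comm]
  apply mul_le_mul_of_nonneg_right _ (abs_nonneg _)
  rw [sq]
  exact mul_le_mul (hB₁.trans hr) (hB₂.trans hr) hB₂0 hr0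

variable {β : ℕ → ℝ} {T : ℝ → ℕ → ℕ → ℝ}

/-- `T σ N n` is the depth-`N` truncation `1/[σβₙ; σβₙ₊₁, …, σβₙ₊N₋₁]` of the `n`-th tail continued
fraction with elements `σβⱼ ≥ 2σ > 0` (FSV (5.14)): the truncations lie in `[0, 1/(σβₙ)]`.
[cite: FriedlanderStraussVishik1997, §5 (5.14)–(5.16)] -/
theorem cf_bounds (H : (∀ n, 2 ≤ β n) ∧ (∀ σ n, T σ 0 n = 0) ∧
      ∀ σ N n, T σ (N + 1) n = 1 / (σ * β n + T σ N (n + 1)))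
    {σ : ℝ} (hσ : 0 < σ) (N n : ℕ) : 0 ≤ T σ N n ∧ T σ N n ≤ 1 / (σ * β n) := by
  induction N generalizing n with
  | zero =>
    have : 0 < σ * β n := mul_pos hσ (by linarith [H.1 n])
    rw [H.2.1]
    exact ⟨le_rfl, by positivity⟩
  | succ N ih =>
    have ha : 0 < σ * β n := mul_pos hσ (by linarith [H.1 n])
    have ht := (ih (n + 1)).1
    rw [H.2.2]
    exact ⟨by positivity, one_div_le_one_div_of_le ha (le_add_of_nonneg_right ht)⟩

/-- Elements bounded below: `σβₙ ≥ 2ε` for `σ ≥ ε`. [folklore] -/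
theorem cf_elem_ge (H : (∀ n, 2 ≤ β n) ∧ (∀ σ n, T σ 0 n = 0) ∧
      ∀ σ N n, T σ (N + 1) n = 1 / (σ * β n + T σ N (n + 1)))
    {σ ε : ℝ} (hε : 0 < ε) (hσ : ε ≤ σ) (n : ℕ) : ε * 2 ≤ σ * β n :=
  mul_le_mul hσ (H.1 n) (by norm_num) (hε.le.trans hσ)

/-- Crude bound: two truncations of the same tail differ by at most `1/(2ε)`. [folklore] -/
theorem cf_crude (H : (∀ n, 2 ≤ β n) ∧ (∀ σ n, T σ 0 n = 0) ∧
      ∀ σ N n, T σ (N + 1) n = 1 / (σ * β n + T σ N (n + 1)))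
    {σ ε : ℝ} (hε : 0 < ε) (hσ : ε ≤ σ) (N N' n : ℕ) : |T σ N n - T σ N' n| ≤ 1 / (2 * ε) := by
  have hσ0 : 0 < σ := lt_of_lt_of_le hε hσ
  obtain ⟨h1, h2⟩ := cf_bounds H hσ0 N n
  obtain ⟨h3, h4⟩ := cf_bounds H hσ0 N' n
  have h5 : 1 / (σ * β n) ≤ 1 / (2 * ε) :=
    one_div_le_one_div_of_le (by positivity) (by linarith [cf_elem_ge H hε hσ n])
  rw [abs_sub_le_iff]
  constructor <;> linarith

/-- Two-step contraction of the truncations (the elements are positive and bounded away from zero,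
so "the partial denominators grow exponentially", FSV p. 206).
[cite: FriedlanderStraussVishik1997, §5, p. 206] -/
theorem cf_contract (H : (∀ n, 2 ≤ β n) ∧ (∀ σ n, T σ 0 n = 0) ∧
      ∀ σ N n, T σ (N + 1) n = 1 / (σ * β n + T σ N (n + 1)))
    {σ ε : ℝ} (hε : 0 < ε) (hσ : ε ≤ σ) (N n : ℕ) :
    |T σ (N + 2) n - T σ (N + 3) n| ≤
      (1 / (1 + 4 * ε ^ 2)) ^ 2 * |T σ N (n + 2) - T σ (N + 1) (n + 2)| := by
  have hσ0 : 0 < σ := lt_of_lt_of_le hε hσ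
  have ha : 0 < σ * β n := mul_pos hσ0 (by linarith [H.1 n])
  have ha' : 0 < σ * β (n + 1) := mul_pos hσ0 (by linarith [H.1 (n + 1)])
  have hs₁ := (cf_bounds H hσ0 N (n + 2)).1
  have hs₂ := (cf_bounds H hσ0 (N + 1) (n + 2)).1
  have hr : 1 / (1 + σ * β n * (σ * β (n + 1))) ≤ 1 / (1 + 4 * ε ^ 2) := by
    apply one_div_le_one_div_of_le (by positivity)
    have h1 := cf_elem_ge H hε hσ n
    have h2 := cf_elem_ge H hε hσ (n + 1)
    nlinarith [mul_le_mul h1 h2 (by positivity) ha.le]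
  have e1 : T σ (N + 2) n = 1 / (σ * β n + T σ (N + 1) (n + 1)) := H.2.2 σ (N + 1) n
  have e2 : T σ (N + 3) n = 1 / (σ * β n + T σ (N + 2) (n + 1)) := H.2.2 σ (N + 2) n
  have e3 : T σ (N + 1) (n + 1) = 1 / (σ * β (n + 1) + T σ N (n + 2)) := H.2.2 σ N (n + 1)
  have e4 : T σ (N + 2) (n + 1) = 1 / (σ * β (n + 1) + T σ (N + 1) (n + 2)) :=
    H.2.2 σ (N + 1) (n + 1)
  rw [e1, e2, e3, e4]
  exact cf_aux_two_step_abs ha ha' hs₁ hs₂ hr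

/-- Geometric bound on consecutive truncations, uniform in `σ ≥ ε`:
`|T σ N n − T σ (N+1) n| ≤ C(ε) r(ε)^N` with `r(ε) = 1/(1+4ε²) < 1`.
[cite: FriedlanderStraussVishik1997, §5, p. 206] -/
theorem cf_geom (H : (∀ n, 2 ≤ β n) ∧ (∀ σ n, T σ 0 n = 0) ∧
      ∀ σ N n, T σ (N + 1) n = 1 / (σ * β n + T σ N (n + 1)))
    {σ ε : ℝ} (hε : 0 < ε) (hσ : ε ≤ σ) (N n : ℕ) :
    |T σ N n - T σ (N + 1) n| ≤ (1 + 4 * ε ^ 2) / (2 * ε) * (1 / (1 + 4 * ε ^ 2)) ^ N := by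
  set r : ℝ := 1 / (1 + 4 * ε ^ 2) with hr
  set C : ℝ := (1 + 4 * ε ^ 2) / (2 * ε) with hC
  suffices key : ∀ N, (∀ n, |T σ N n - T σ (N + 1) n| ≤ C * r ^ N) ∧
      (∀ n, |T σ (N + 1) n - T σ (N + 2) n| ≤ C * r ^ (N + 1)) from (key N).1 n
  intro N
  induction N with
  | zero =>
    constructor
    · intro n
      rw [pow_zero, mul_one]
      calc |T σ 0 n - T σ 1 n| ≤ 1 / (2 * ε) := cf_crude H hε hσ 0 1 n
        _ ≤ C := by
          rw [hC]
          apply div_le_div_of_nonneg_right _ (by positivity)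
          nlinarith
    · intro n
      rw [zero_add, pow_one]
      calc |T σ 1 n - T σ 2 n| ≤ 1 / (2 * ε) := cf_crude H hε hσ 1 2 n
        _ = C * r := by rw [hC, hr]; field_simp
  | succ N ih =>
    refine ⟨ih.2, fun n => ?_⟩
    calc |T σ (N + 1 + 1) n - T σ (N + 1 + 2) n|
        ≤ r ^ 2 * |T σ N (n + 2) - T σ (N + 1) (n + 2)| := cf_contract H hε hσ N n
      _ ≤ r ^ 2 * (C * r ^ N) := by gcongr; exact ih.1 (n + 2)
      _ = C * r ^ (N + 1 + 1) := by ring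

/-- The rate `r(ε) = 1/(1+4ε²)` lies in `[0,1)`. [folklore] -/
theorem cf_rate_lt_one {ε : ℝ} (hε : 0 < ε) :
    0 ≤ 1 / (1 + 4 * ε ^ 2) ∧ 1 / (1 + 4 * ε ^ 2) < 1 :=
  ⟨by positivity, (div_lt_one (by positivity)).2 (by nlinarith)⟩

/-- The truncations of each tail form a Cauchy sequence ("the continued fraction in the RHS of (5.14)
is convergent"). [cite: FriedlanderStraussVishik1997, §5 (5.14)] -/
theorem cf_cauchySeq (H : (∀ n, 2 ≤ β n) ∧ (∀ σ n, T σ 0 n = 0) ∧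
      ∀ σ N n, T σ (N + 1) n = 1 / (σ * β n + T σ N (n + 1)))
    {σ : ℝ} (hσ : 0 < σ) (n : ℕ) : CauchySeq fun N => T σ N n :=
  cauchySeq_of_le_geometric _ _ (cf_rate_lt_one hσ).2 fun N => by
    rw [Real.dist_eq]; exact cf_geom H hσ le_rfl N n

/-- Existence of the limits `u σ n = lim_N T σ N n` (the infinite tail continued fractions) for all
`σ > 0`. [cite: FriedlanderStraussVishik1997, §5 (5.14)] -/
theorem cf_exists_limit (H : (∀ n, 2 ≤ β n) ∧ (∀ σ n, T σ 0 n = 0) ∧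
      ∀ σ N n, T σ (N + 1) n = 1 / (σ * β n + T σ N (n + 1))) :
    ∃ u : ℝ → ℕ → ℝ, ∀ σ, 0 < σ → ∀ n, Tendsto (fun N => T σ N n) atTop (𝓝 (u σ n)) :=
  ⟨fun σ n => limUnder atTop fun N => T σ N n, fun _ hσ n => (cf_cauchySeq H hσ n).tendsto_limUnder⟩

/-- A-priori error bound `dist (T σ N n) (lim) ≤ C(ε) r(ε)^N / (1 − r(ε))`, uniform in `σ ≥ ε`.
[folklore] -/
theorem cf_dist_limit (H : (∀ n, 2 ≤ β n) ∧ (∀ σ n, T σ 0 n = 0) ∧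
      ∀ σ N n, T σ (N + 1) n = 1 / (σ * β n + T σ N (n + 1)))
    {σ ε ℓ : ℝ} (hε : 0 < ε) (hσ : ε ≤ σ) {n : ℕ}
    (hℓ : Tendsto (fun N => T σ N n) atTop (𝓝 ℓ)) (N : ℕ) :
    dist (T σ N n) ℓ ≤
      (1 + 4 * ε ^ 2) / (2 * ε) * (1 / (1 + 4 * ε ^ 2)) ^ N / (1 - 1 / (1 + 4 * ε ^ 2)) :=
  dist_le_of_le_geometric_of_tendsto _ _ (cf_rate_lt_one hε).2
    (fun N => by rw [Real.dist_eq]; exact cf_geom H hε hσ N n) hℓ N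

/-- Each truncation is a continuous (rational) function of `σ > 0`. [folklore] -/
theorem cf_continuousOn_trunc (H : (∀ n, 2 ≤ β n) ∧ (∀ σ n, T σ 0 n = 0) ∧
      ∀ σ N n, T σ (N + 1) n = 1 / (σ * β n + T σ N (n + 1))) (N n : ℕ) :
    ContinuousOn (fun σ => T σ N n) (Set.Ioi 0) := by
  induction N generalizing n with
  | zero => simp only [H.2.1]; exact continuousOn_const
  | succ N ih =>
    have h : (fun σ => T σ (N + 1) n) = fun σ => 1 / (σ * β n + T σ N (n + 1)) :=
      funext fun σ => H.2.2 σ N n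
    rw [h]
    refine ContinuousOn.div continuousOn_const
      ((continuousOn_id.mul continuousOn_const).add (ih (n + 1))) fun σ hσ => ?_
    have h1 := (cf_bounds H (σ := σ) hσ N (n + 1)).1
    have h2 : 0 < σ * β n := mul_pos hσ (by linarith [H.1 n])
    exact (add_pos_of_pos_of_nonneg h2 h1).ne'

/-- "F(σ) … is a continuous function because the sequence of partial fractions is uniformly
convergent on [ε, ∞) for any ε > 0 (with exponential estimate)" (FSV p. 207): the limit tails are
continuous in `σ` on `[ε, ∞)`. [cite: FriedlanderStraussVishik1997, §5, p. 207] -/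
theorem cf_continuousOn_limit (H : (∀ n, 2 ≤ β n) ∧ (∀ σ n, T σ 0 n = 0) ∧
      ∀ σ N n, T σ (N + 1) n = 1 / (σ * β n + T σ N (n + 1)))
    {u : ℝ → ℕ → ℝ} (hu : ∀ σ, 0 < σ → ∀ n, Tendsto (fun N => T σ N n) atTop (𝓝 (u σ n)))
    {ε : ℝ} (hε : 0 < ε) (n : ℕ) : ContinuousOn (fun σ => u σ n) (Set.Ici ε) := by
  have hunif : TendstoUniformlyOn (fun N σ => T σ N n) (fun σ => u σ n) atTop (Set.Ici ε) := by
    rw [Metric.tendstoUniformlyOn_iff]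
    intro δ hδ
    obtain ⟨hr0, hr1⟩ := cf_rate_lt_one hε
    have htend : Tendsto (fun N => (1 + 4 * ε ^ 2) / (2 * ε) * (1 / (1 + 4 * ε ^ 2)) ^ N /
        (1 - 1 / (1 + 4 * ε ^ 2))) atTop
        (𝓝 ((1 + 4 * ε ^ 2) / (2 * ε) * 0 / (1 - 1 / (1 + 4 * ε ^ 2)))) :=
      ((tendsto_pow_atTop_nhds_zero_of_lt_one hr0 hr1).const_mul _).div_const _
    rw [mul_zero, zero_div] at htend
    filter_upwards [htend.eventually_lt_const hδ] with N hN σ hσ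
    rw [dist_comm]
    exact (cf_dist_limit H hε hσ (hu σ (hε.trans_le hσ) n) N).trans_lt hN
  refine hunif.continuousOn (Filter.Eventually.frequently (Filter.Eventually.of_forall fun N => ?_))
  exact (cf_continuousOn_trunc H N n).mono fun σ hσ => hε.trans_le hσ

/-- The limit tails are positive, bounded by `1/(σβₙ)`, and satisfy the tail relation
`uₙ = 1/(σβₙ + uₙ₊₁)` (FSV (5.12)/(5.14)). [cite: FriedlanderStraussVishik1997, §5 (5.12)–(5.14)] -/
theorem cf_limit_props (H : (∀ n, 2 ≤ β n) ∧ (∀ σ n, T σ 0 n = 0) ∧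
      ∀ σ N n, T σ (N + 1) n = 1 / (σ * β n + T σ N (n + 1)))
    {σ : ℝ} (hσ : 0 < σ) {u : ℕ → ℝ} (hu : ∀ n, Tendsto (fun N => T σ N n) atTop (𝓝 (u n)))
    (n : ℕ) : 0 < u n ∧ u n ≤ 1 / (σ * β n) ∧ u n = 1 / (σ * β n + u (n + 1)) := by
  have hnn : ∀ k, 0 ≤ u k := fun k => ge_of_tendsto' (hu k) fun N => (cf_bounds H hσ N k).1
  have hle : ∀ k, u k ≤ 1 / (σ * β k) := fun k =>
    le_of_tendsto' (hu k) fun N => (cf_bounds H hσ N k).2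
  have ha : 0 < σ * β n := mul_pos hσ (by linarith [H.1 n])
  have hden : 0 < σ * β n + u (n + 1) := add_pos_of_pos_of_nonneg ha (hnn _)
  have hrel : u n = 1 / (σ * β n + u (n + 1)) := by
    have h1 : Tendsto (fun N => T σ (N + 1) n) atTop (𝓝 (u n)) :=
      (hu n).comp (tendsto_add_atTop_nat 1)
    have h2 : Tendsto (fun N => T σ (N + 1) n) atTop (𝓝 (1 / (σ * β n + u (n + 1)))) := by
      simp only [H.2.2]
      exact Filter.Tendsto.div tendsto_const_nhds (tendsto_const_nhds.add (hu (n + 1))) hden.ne'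
    exact tendsto_nhds_unique h1 h2
  exact ⟨by rw [hrel]; exact one_div_pos.2 hden, hle n, hrel⟩

/-! ### B. The characteristic equation (FSV (5.20), Fig. 2) -/

/-- **Existence of a root of the characteristic equation** `u₀(σ) = σ/(M−1)` (FSV (5.20):
`−a₀/2 = F(σ)`) on `[1/4, 1]`, for `β₀ = 2(M+1)`, `M ≥ 4`: at `σ = 1/4` the tail exceeds the line
(lower bound `u₀ ≥ 1/(σβ₀ + 1/(2σ))`, cf. (5.22)–(5.24)), at `σ = 1` it lies below it
(`u₀ ≤ 1/(σβ₀)`), and the tail is continuous in `σ`; conclude by the intermediate value theorem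
(Fig. 2). [cite: FriedlanderStraussVishik1997, §5 (5.20)–(5.24)] -/
theorem exists_sigma (H : (∀ n, 2 ≤ β n) ∧ (∀ σ n, T σ 0 n = 0) ∧
      ∀ σ N n, T σ (N + 1) n = 1 / (σ * β n + T σ N (n + 1)))
    {u : ℝ → ℕ → ℝ} (hu : ∀ σ, 0 < σ → ∀ n, Tendsto (fun N => T σ N n) atTop (𝓝 (u σ n)))
    {M : ℝ} (hM : 4 ≤ M) (hβ0 : β 0 = 2 * (M + 1)) :
    ∃ σ : ℝ, 1 / 4 ≤ σ ∧ σ ≤ 1 ∧ u σ 0 = σ / (M - 1) := by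
  have hM1 : 0 < M - 1 := by linarith
  have hcont : ContinuousOn (fun σ => u σ 0 - σ / (M - 1)) (Set.Icc (1 / 4) 1) :=
    ((cf_continuousOn_limit H hu (by norm_num : (0 : ℝ) < 1 / 4) 0).mono
      Set.Icc_subset_Ici_self).sub (continuousOn_id.div_const _)
  have hq : (0 : ℝ) < 1 / 4 := by norm_num
  -- at σ = 1/4 the tail is above the line
  have hlo : 0 < u (1 / 4) 0 - 1 / 4 / (M - 1) := by
    obtain ⟨-, -, hrel0⟩ := cf_limit_props H hq (hu _ hq) 0
    obtain ⟨-, hle1, -⟩ := cf_limit_props H hq (hu _ hq) 1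
    have hb1 : 0 < 1 / 4 * β 1 := by linarith [H.1 1]
    have hu1 : u (1 / 4) 1 ≤ 2 := by
      refine hle1.trans ?_
      rw [div_le_iff₀ hb1]
      linarith [H.1 1]
    have hb0 : 0 < 1 / 4 * β 0 := by linarith [H.1 0]
    have hlow : 1 / (1 / 4 * β 0 + 2) ≤ u (1 / 4) 0 := by
      rw [hrel0]
      exact one_div_le_one_div_of_le (by linarith [(cf_limit_props H hq (hu _ hq) 1).1])
        (by linarith)
    rw [hβ0] at hlow
    have key : 1 / 4 / (M - 1) < 1 / (1 / 4 * (2 * (M + 1)) + 2) := by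
      rw [div_lt_div_iff₀ hM1 (by positivity)]
      nlinarith
    linarith
  -- at σ = 1 the tail is below the line
  have hhi : u 1 0 - 1 / (M - 1) < 0 := by
    obtain ⟨-, hle0, -⟩ := cf_limit_props H one_pos (hu 1 one_pos) 0
    rw [hβ0, one_mul] at hle0
    have : 1 / (2 * (M + 1)) < 1 / (M - 1) := one_div_lt_one_div_of_lt hM1 (by linarith)
    linarith
  have hmem : (0 : ℝ) ∈ Set.Icc ((fun σ => u σ 0 - σ / (M - 1)) 1)
      ((fun σ => u σ 0 - σ / (M - 1)) (1 / 4)) := ⟨by simpa using hhi.le, hlo.le⟩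
  obtain ⟨σ, ⟨hσ1, hσ2⟩, hσ⟩ := intermediate_value_Icc' (by norm_num : (1 / 4 : ℝ) ≤ 1) hcont hmem
  exact ⟨σ, hσ1, hσ2, sub_eq_zero.1 hσ⟩


/-! ### C. The two-sided sequence `d` (FSV (5.9)–(5.11), (5.21)) -/

/-- **The sequence `dⱼ` of FSV (5.21).** From the tails `vₙ = uₙ(σ)` (positive, `vₙ ≤ 1/(σβₙ)`,
`vₙ = 1/(σβₙ + vₙ₊₁)`) put `d₀ = 1`, `dₙ = (−1)ⁿ v₀⋯vₙ₋₁`, `d₋ₙ = v₀⋯vₙ₋₁`. Then `d` satisfies the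
three-term recurrence (5.9) at every index `≠ 0` (the tail relation), `d₁ − d₋₁ = −2v₀` at the
index `0`, `dₙ ≤ d₋ₙ`, `d₁ < d₋₁`, and decays exponentially ("`d_{pm}, d_{−pm} → 0` exponentially
because of (5.16)–(5.18)"). [cite: FriedlanderStraussVishik1997, §5 (5.9)–(5.11), (5.21)] -/
theorem exists_d {β : ℕ → ℝ} (hβ : ∀ n, 2 ≤ β n) {σ : ℝ} (hσ : 0 < σ) {v : ℕ → ℝ}
    (hv_pos : ∀ n, 0 < v n) (hv_le : ∀ n, v n ≤ 1 / (σ * β n))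
    (hv_rel : ∀ n, v n = 1 / (σ * β n + v (n + 1))) :
    ∃ d : ℤ → ℝ, d 0 = 1 ∧ d 1 - d (-1) = -2 * v 0 ∧
      (∀ n : ℕ, d ((n : ℤ) + 2) - d n = σ * β n * d ((n : ℤ) + 1)) ∧
      (∀ n : ℕ, d (-(n : ℤ)) - d (-(n : ℤ) - 2) = σ * β n * d (-(n : ℤ) - 1)) ∧
      (∀ n : ℕ, d n ≤ d (-(n : ℤ))) ∧ d 1 < d (-1) ∧
      ∃ K ρ : ℝ, 0 ≤ K ∧ 0 < ρ ∧ ρ < 1 ∧ ∀ z : ℤ, |d z| ≤ K * ρ ^ z.natAbs := by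
  have hb : ∀ n, 0 < σ * β n := fun n => mul_pos hσ (by linarith [hβ n])
  have hden : ∀ n, 0 < σ * β n + v (n + 1) := fun n => add_pos (hb n) (hv_pos _)
  have hkey : ∀ n, v n * v (n + 1) = 1 - σ * β n * v n := by
    intro n
    have h1 : v n * (σ * β n + v (n + 1)) = 1 := by
      rw [hv_rel n]; field_simp [(hden n).ne']
    linear_combination h1
  have hpair : ∀ n, v n * v (n + 1) ≤ 1 / (1 + 4 * σ ^ 2) := by
    intro n
    have h := cf_aux_pair (hb n) (hb (n + 1)) (hv_pos (n + 1)).le (hv_le (n + 1))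
    rw [← hv_rel n] at h
    refine h.trans (one_div_le_one_div_of_le (by positivity) ?_)
    have h1 : σ * 2 ≤ σ * β n := by nlinarith [hβ n]
    have h2 : σ * 2 ≤ σ * β (n + 1) := by nlinarith [hβ (n + 1)]
    nlinarith [mul_le_mul h1 h2 (by positivity) (hb n).le]
  -- partial products
  obtain ⟨P, hP0, hPs, hPpos⟩ : ∃ P : ℕ → ℝ, P 0 = 1 ∧ (∀ n, P (n + 1) = P n * v n) ∧
      ∀ n, 0 < P n :=
    ⟨fun n => ∏ i ∈ Finset.range n, v i, Finset.prod_range_zero v,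
      fun n => Finset.prod_range_succ v n, fun n => Finset.prod_pos fun i _ => hv_pos i⟩
  -- exponential decay of the partial products
  obtain ⟨hr0, hr1⟩ := cf_rate_lt_one hσ
  set r : ℝ := 1 / (1 + 4 * σ ^ 2) with hr_def
  set ρ : ℝ := (1 + r) / 2 with hρ_def
  have hρ0 : 0 < ρ := by rw [hρ_def]; linarith
  have hρ1 : ρ < 1 := by rw [hρ_def]; linarith
  have hrρ : r ≤ ρ ^ 2 := by rw [hρ_def]; nlinarith [sq_nonneg (1 - r)]
  set K : ℝ := 1 + 1 / (2 * σ * ρ) with hK_def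
  have hK1 : 1 ≤ K := by rw [hK_def]; simp only [le_add_iff_nonneg_right]; positivity
  have hKρ : K * ρ = ρ + 1 / (2 * σ) := by
    rw [hK_def]; field_simp
  have hPdecay : ∀ n, P n ≤ K * ρ ^ n ∧ P (n + 1) ≤ K * ρ ^ (n + 1) := by
    intro n
    induction n with
    | zero =>
      refine ⟨by rw [hP0, pow_zero, mul_one]; exact hK1, ?_⟩
      rw [hPs, hP0, one_mul, zero_add, pow_one]
      calc v 0 ≤ 1 / (σ * β 0) := hv_le 0
        _ ≤ 1 / (2 * σ) := one_div_le_one_div_of_le (by positivity) (by nlinarith [hβ 0])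
        _ ≤ K * ρ := by rw [hKρ]; linarith
    | succ n ih =>
      refine ⟨ih.2, ?_⟩
      rw [hPs, hPs]
      calc P n * v n * v (n + 1) = P n * (v n * v (n + 1)) := by ring
        _ ≤ K * ρ ^ n * ρ ^ 2 :=
          mul_le_mul ih.1 ((hpair n).trans hrρ) (mul_pos (hv_pos _) (hv_pos _)).le
            (by positivity)
        _ = K * ρ ^ (n + 1 + 1) := by ring
  -- the two-sided sequence
  obtain ⟨d, hd_nat, hd_neg⟩ : ∃ d : ℤ → ℝ, (∀ n : ℕ, d n = (-1) ^ n * P n) ∧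
      ∀ n : ℕ, d (-(n : ℤ)) = P n := by
    refine ⟨fun z => if 0 ≤ z then (-1) ^ z.toNat * P z.toNat else P z.natAbs,
      fun n => ?_, fun n => ?_⟩
    · simp only [Nat.cast_nonneg, if_true, Int.toNat_natCast]
    · cases n with
      | zero => simp [hP0]
      | succ k =>
        have hlt : ¬ (0 : ℤ) ≤ -((k + 1 : ℕ) : ℤ) := by omega
        simp only [hlt, if_false, Int.natAbs_neg, Int.natAbs_natCast]
  have hd0 : d 0 = 1 := by
    have := hd_nat 0
    rwa [Nat.cast_zero, pow_zero, one_mul, hP0] at this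
  have hP1 : P 1 = v 0 := by rw [hPs, hP0, one_mul]
  have hd1 : d 1 = -v 0 := by
    have := hd_nat 1
    rwa [Nat.cast_one, pow_one, hP1, neg_one_mul] at this
  have hdm1 : d (-1) = v 0 := by
    have := hd_neg 1
    rwa [Nat.cast_one, hP1] at this
  refine ⟨d, hd0, by rw [hd1, hdm1]; ring, fun n => ?_, fun n => ?_, fun n => ?_,
    by rw [hd1, hdm1]; linarith [hv_pos 0], K, ρ, by linarith, hρ0, hρ1, fun z => ?_⟩
  · -- recurrence at the index n + 1 ≥ 1
    have e1 : d ((n : ℤ) + 2) = (-1) ^ (n + 2) * P (n + 2) := by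
      have := hd_nat (n + 2); push_cast at this; exact this
    have e2 : d ((n : ℤ) + 1) = (-1) ^ (n + 1) * P (n + 1) := by
      have := hd_nat (n + 1); push_cast at this; exact this
    rw [e1, e2, hd_nat n, hPs (n + 1), hPs n]
    linear_combination ((-1 : ℝ) ^ n * P n) * hkey n
  · -- recurrence at the index -(n + 1) ≤ -1
    have e1 : d (-(n : ℤ) - 2) = P (n + 2) := by
      have := hd_neg (n + 2); push_cast at this
      rw [show (-(n : ℤ) - 2) = -((n : ℤ) + 2) by ring]; exact this
    have e2 : d (-(n : ℤ) - 1) = P (n + 1) := by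
      have := hd_neg (n + 1); push_cast at this
      rw [show (-(n : ℤ) - 1) = -((n : ℤ) + 1) by ring]; exact this
    rw [e1, e2, hd_neg n, hPs (n + 1), hPs n]
    linear_combination (-P n) * hkey n
  · -- dₙ ≤ d₋ₙ
    rw [hd_nat, hd_neg]
    rcases neg_one_pow_eq_or ℝ n with h | h <;> rw [h] <;> nlinarith [hPpos n]
  · -- exponential decay
    obtain ⟨n, rfl | rfl⟩ := z.eq_nat_or_neg
    · rw [hd_nat, Int.natAbs_natCast, abs_mul, abs_pow, abs_neg, abs_one, one_pow, one_mul,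
        abs_of_pos (hPpos n)]
      exact (hPdecay n).1
    · rw [hd_neg, Int.natAbs_neg, Int.natAbs_natCast, abs_of_pos (hPpos n)]
      exact (hPdecay n).1


/-! ### D. Exponentially decaying Fourier series: analyticity in a strip, algebra of the ODE -/

/-- A Fourier series `Σ_z b_z e^{iν_z w}` with `Σ_z ‖b_z‖ e^{|ν_z|δ} < ∞` is holomorphic in the strip
`|Im w| < δ`, its derivative is the termwise differentiated series, and it converges absolutely
there. [folklore] -/
theorem strip_hasDerivAt {b : ℤ → ℂ} {ν : ℤ → ℝ} {g : ℤ → ℝ} {δ : ℝ} (hg : Summable g)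
    (hb : ∀ z, ‖b z‖ * Real.exp (|ν z| * δ) ≤ g z) {w : ℂ} (hw : |w.im| < δ) :
    HasDerivAt (fun w => ∑' z, b z * cexp (ν z * w * I))
        (∑' z, b z * (ν z * I) * cexp (ν z * w * I)) w ∧
      DifferentiableOn ℂ (fun w => ∑' z, b z * cexp (ν z * w * I)) {w : ℂ | |w.im| < δ} ∧
      Summable (fun z => b z * cexp (ν z * w * I)) := by
  have hU : IsOpen {w : ℂ | |w.im| < δ} :=
    isOpen_lt (continuous_abs.comp Complex.continuous_im) continuous_const
  have hF : ∀ z, DifferentiableOn ℂ (fun w => b z * cexp (ν z * w * I)) {w : ℂ | |w.im| < δ} :=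
    fun z => ((differentiable_const _).mul
      (((differentiable_id.const_mul _).mul_const _).cexp)).differentiableOn
  have hle : ∀ z, ∀ w ∈ {w : ℂ | |w.im| < δ}, ‖b z * cexp (ν z * w * I)‖ ≤ g z := by
    intro z w hw
    rw [norm_mul, Complex.norm_exp]
    refine le_trans ?_ (hb z)
    gcongr
    rw [Complex.mul_I_re, Complex.im_ofReal_mul]
    have hw' : |w.im| < δ := hw
    calc -(ν z * w.im) ≤ |ν z * w.im| := neg_le_abs _
      _ = |ν z| * |w.im| := abs_mul _ _
      _ ≤ |ν z| * δ := by gcongr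
  have hdiff := Complex.differentiableOn_tsum_of_summable_norm hg hF hU hle
  refine ⟨?_, hdiff, Summable.of_norm_bounded hg fun z => hle z w hw⟩
  have hsum := Complex.hasSum_deriv_of_summable_norm hg hF hU hle hw
  have hterm : ∀ z, deriv (fun w => b z * cexp (ν z * w * I)) w =
      b z * (ν z * I) * cexp (ν z * w * I) := by
    intro z
    have h1 : HasDerivAt (fun w : ℂ => (ν z : ℂ) * w * I) ((ν z : ℂ) * 1 * I) w :=
      ((hasDerivAt_id w).const_mul _).mul_const _
    have h2 : HasDerivAt (fun w : ℂ => b z * cexp (ν z * w * I))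
        (b z * (cexp (ν z * w * I) * ((ν z : ℂ) * 1 * I))) w := h1.cexp.const_mul (b z)
    rw [h2.deriv]
    ring
  simp only [hterm] at hsum
  rw [hsum.tsum_eq]
  exact (hdiff.differentiableAt (hU.mem_nhds hw)).hasDerivAt

/-- Geometric decay `|c_z| ≤ Kρ^{|z|}` of real Fourier coefficients gives the weighted summability
needed in `strip_hasDerivAt` for the series with coefficients `c_z (iν_z)^j`, `j ≤ 2`, `ν_z = zμ`,
in the strip of half-width `δ = log(t/ρ)/μ`, `t = (1+ρ)/2`. [folklore] -/
theorem decay_summable {c : ℤ → ℝ} {K ρ μ : ℝ} (hK : 0 ≤ K) (hρ0 : 0 < ρ) (hρ1 : ρ < 1)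
    (hc : ∀ z, |c z| ≤ K * ρ ^ z.natAbs) (hμ : 1 ≤ μ) :
    ∃ δ : ℝ, 0 < δ ∧ ∃ g : ℤ → ℝ, Summable g ∧ ∀ j : ℕ, j ≤ 2 → ∀ z : ℤ,
      ‖(c z : ℂ) * ((((z : ℝ) * μ : ℝ) : ℂ) * I) ^ j‖ * Real.exp (|(z : ℝ) * μ| * δ) ≤ g z := by
  set t : ℝ := (1 + ρ) / 2 with ht_def
  have ht0 : 0 < t := by rw [ht_def]; linarith
  have ht1 : t < 1 := by rw [ht_def]; linarith
  have hρt : ρ < t := by rw [ht_def]; linarith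
  have hμ0 : 0 < μ := by linarith
  have htρ : 1 < t / ρ := (one_lt_div hρ0).2 hρt
  refine ⟨Real.log (t / ρ) / μ, div_pos (Real.log_pos htρ) hμ0,
    fun z => K * μ ^ 2 * (((z.natAbs : ℝ) + 1) ^ 2 * t ^ z.natAbs), ?_, ?_⟩
  · -- summability over ℤ from summability over ℕ
    have hnat : Summable fun n : ℕ => ((n : ℝ) + 1) ^ 2 * t ^ n := by
      have h : ∀ k : ℕ, Summable fun n : ℕ => (n : ℝ) ^ k * t ^ n := fun k =>
        summable_pow_mul_geometric_of_norm_lt_one k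
          (by rw [Real.norm_eq_abs, abs_of_pos ht0]; exact ht1)
      have : (fun n : ℕ => ((n : ℝ) + 1) ^ 2 * t ^ n) = fun n : ℕ =>
          (n : ℝ) ^ 2 * t ^ n + 2 * ((n : ℝ) ^ 1 * t ^ n) + (n : ℝ) ^ 0 * t ^ n := by
        funext n; ring
      rw [this]
      exact ((h 2).add ((h 1).mul_left 2)).add (h 0)
    refine Summable.mul_left _ (summable_int_iff_summable_nat_and_neg.2 ⟨?_, ?_⟩)
    · simpa only [Int.natAbs_natCast] using hnat
    · simpa only [Int.natAbs_neg, Int.natAbs_natCast] using hnat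
  · intro j hj z
    have habs : |(z : ℝ)| = (z.natAbs : ℝ) := by
      rw [Nat.cast_natAbs, Int.cast_abs]
    have hexp : Real.exp (|(z : ℝ) * μ| * (Real.log (t / ρ) / μ)) = (t / ρ) ^ z.natAbs := by
      rw [abs_mul, abs_of_pos hμ0, habs, show (z.natAbs : ℝ) * μ * (Real.log (t / ρ) / μ)
        = (z.natAbs : ℝ) * Real.log (t / ρ) by field_simp, Real.exp_nat_mul,
        Real.exp_log (by positivity)]
    have hnorm : ‖(c z : ℂ) * ((((z : ℝ) * μ : ℝ) : ℂ) * I) ^ j‖ =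
        |c z| * ((z.natAbs : ℝ) * μ) ^ j := by
      rw [norm_mul, norm_pow, norm_mul, Complex.norm_real, Complex.norm_real, Complex.norm_I,
        mul_one, Real.norm_eq_abs, Real.norm_eq_abs, abs_mul, abs_of_pos hμ0, habs]
    rw [hexp, hnorm]
    have h1 : ((z.natAbs : ℝ) * μ) ^ j ≤ (((z.natAbs : ℝ) + 1) * μ) ^ 2 := by
      calc ((z.natAbs : ℝ) * μ) ^ j ≤ (((z.natAbs : ℝ) + 1) * μ) ^ j := by
            gcongr; linarith
        _ ≤ (((z.natAbs : ℝ) + 1) * μ) ^ 2 := by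
            apply pow_le_pow_right₀ _ hj
            nlinarith [(Nat.cast_nonneg z.natAbs : (0 : ℝ) ≤ z.natAbs)]
    have h2 : (t / ρ) ^ z.natAbs = t ^ z.natAbs / ρ ^ z.natAbs := div_pow t ρ _
    have hρpow : 0 < ρ ^ z.natAbs := pow_pos hρ0 _
    calc |c z| * ((z.natAbs : ℝ) * μ) ^ j * (t / ρ) ^ z.natAbs
        ≤ K * ρ ^ z.natAbs * (((z.natAbs : ℝ) + 1) * μ) ^ 2 * (t / ρ) ^ z.natAbs := by
          gcongr
          exact hc z
      _ = K * μ ^ 2 * (((z.natAbs : ℝ) + 1) ^ 2 * t ^ z.natAbs) := by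
          rw [h2]; field_simp

/-- Shifting the argument by `2π` does not change a Fourier series with integer frequencies `zm`.
[folklore] -/
theorem tsum_periodic (b : ℤ → ℂ) (m : ℕ) (y : ℝ) :
    (∑' z : ℤ, b z * cexp ((((z : ℝ) * m : ℝ) : ℂ) * ((y + 2 * Real.pi : ℝ) : ℂ) * I)) =
      ∑' z : ℤ, b z * cexp ((((z : ℝ) * m : ℝ) : ℂ) * (y : ℂ) * I) := by
  refine tsum_congr fun z => ?_
  congr 1
  rw [show (((z : ℝ) * m : ℝ) : ℂ) * ((y + 2 * Real.pi : ℝ) : ℂ) * I =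
      (((z : ℝ) * m : ℝ) : ℂ) * (y : ℂ) * I + ((z * m : ℤ) : ℂ) * (2 * Real.pi * I) by
        push_cast; ring,
    Complex.exp_add, Complex.exp_int_mul_two_pi_mul_I, mul_one]

/-- `i sin x = (e^{ix} − e^{−ix})/2`. [folklore] -/
theorem I_mul_sin (x : ℝ) :
    I * (Real.sin x : ℂ) = (cexp ((x : ℂ) * I) - cexp (-(x : ℂ) * I)) / 2 := by
  rw [Complex.ofReal_sin]
  linear_combination (I / 2) * Complex.two_sin (x : ℂ) +
    (-(cexp ((x : ℂ) * I) - cexp (-(x : ℂ) * I)) / 2) * I_mul_I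

/-- **The Fourier-side computation of FSV §5** ((5.5) ⇔ (5.6) ⇔ (5.9)): if `φ = Σ c_z E_z`,
`φ'' = Σ c_z (−z²M) E_z`, `d_z = e_z c_z` with `e_z = (z² − 1)M + 1`, the `d_z` satisfy
`2σ w_z c_z + d_{z−1} − d_{z+1} = 0` (`w_z = z²M + 1`), and `E_{±1} E_z = E_{z±1}`, then
`(σ + (E₁ − E₋₁)/2)(φ'' − φ) + (E₁ − E₋₁)/2 · M φ = 0` — the Rayleigh equation with
`i sin(my) = (E₁ − E₋₁)/2`. [cite: FriedlanderStraussVishik1997, §5 (5.5)–(5.9)] -/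
theorem ode_algebra {σ M : ℝ} {c d : ℤ → ℝ} {E : ℤ → ℂ} {Φ₀ Φ₂ : ℂ}
    (hΦ₀ : HasSum (fun z => (c z : ℂ) * E z) Φ₀)
    (hΦ₂ : HasSum (fun z => (c z : ℂ) * (-(((z : ℝ) ^ 2 * M : ℝ) : ℂ)) * E z) Φ₂)
    (hd : ∀ z : ℤ, ((z : ℝ) ^ 2 * M + 1) * c z - M * c z = d z)
    (hrec : ∀ z : ℤ, 2 * σ * (((z : ℝ) ^ 2 * M + 1) * c z) + d (z - 1) - d (z + 1) = 0)
    (hE₁ : ∀ z, E 1 * E z = E (z + 1)) (hEm1 : ∀ z, E (-1) * E z = E (z - 1)) :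
    ((σ : ℂ) + (E 1 - E (-1)) / 2) * (Φ₂ - Φ₀) + (E 1 - E (-1)) / 2 * M * Φ₀ = 0 := by
  -- W = Φ₀ - Φ₂ = Σ w_z c_z E_z
  have hW : HasSum (fun z : ℤ => ((((z : ℝ) ^ 2 * M + 1) * c z : ℝ) : ℂ) * E z) (Φ₀ - Φ₂) := by
    have h := hΦ₀.sub hΦ₂
    have heq : (fun z : ℤ => (c z : ℂ) * E z - (c z : ℂ) * (-(((z : ℝ) ^ 2 * M : ℝ) : ℂ)) * E z) =
        fun z : ℤ => ((((z : ℝ) ^ 2 * M + 1) * c z : ℝ) : ℂ) * E z := by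
      funext z; push_cast; ring
    rw [heq] at h
    exact h
  -- D = W - M Φ₀ = Σ d_z E_z
  have hD : HasSum (fun z : ℤ => (d z : ℂ) * E z) (Φ₀ - Φ₂ - M * Φ₀) := by
    have h := hW.sub (hΦ₀.mul_left (M : ℂ))
    have heq : (fun z : ℤ => ((((z : ℝ) ^ 2 * M + 1) * c z : ℝ) : ℂ) * E z -
        (M : ℂ) * ((c z : ℂ) * E z)) = fun z : ℤ => (d z : ℂ) * E z := by
      funext z; rw [← hd z]; push_cast; ring
    rw [heq] at h
    exact h
  -- shifted series E_{±1} D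
  have hD₁ : HasSum (fun z : ℤ => (d (z - 1) : ℂ) * E z) (E 1 * (Φ₀ - Φ₂ - M * Φ₀)) := by
    have h := hD.mul_left (E 1)
    have heq : (fun z : ℤ => (d (z - 1) : ℂ) * E z) ∘ (Equiv.addRight (1 : ℤ)) =
        fun i : ℤ => E 1 * ((d i : ℂ) * E i) := by
      funext z
      simp only [Function.comp_apply, Equiv.coe_addRight, add_sub_cancel_right]
      rw [← hE₁ z]; ring
    rw [← heq] at h
    exact (Equiv.addRight (1 : ℤ)).hasSum_iff.mp h
  have hDm1 : HasSum (fun z : ℤ => (d (z + 1) : ℂ) * E z) (E (-1) * (Φ₀ - Φ₂ - M * Φ₀)) := by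
    have h := hD.mul_left (E (-1))
    have heq : (fun z : ℤ => (d (z + 1) : ℂ) * E z) ∘ (Equiv.subRight (1 : ℤ)) =
        fun i : ℤ => E (-1) * ((d i : ℂ) * E i) := by
      funext z
      simp only [Function.comp_apply, Equiv.subRight_apply, sub_add_cancel]
      rw [← hEm1 z]; ring
    rw [← heq] at h
    exact (Equiv.subRight (1 : ℤ)).hasSum_iff.mp h
  -- the combination whose coefficients vanish by the recurrence
  have hcomb : HasSum (fun z : ℤ => ((2 * σ * (((z : ℝ) ^ 2 * M + 1) * c z) + d (z - 1) -
      d (z + 1) : ℝ) : ℂ) * E z)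
      (2 * (σ : ℂ) * (Φ₀ - Φ₂) + E 1 * (Φ₀ - Φ₂ - M * Φ₀) - E (-1) * (Φ₀ - Φ₂ - M * Φ₀)) := by
    have h := ((hW.mul_left (2 * (σ : ℂ))).add hD₁).sub hDm1
    have heq : (fun z : ℤ => 2 * (σ : ℂ) * (((((z : ℝ) ^ 2 * M + 1) * c z : ℝ) : ℂ) * E z) +
        (d (z - 1) : ℂ) * E z - (d (z + 1) : ℂ) * E z) =
        fun z : ℤ => ((2 * σ * (((z : ℝ) ^ 2 * M + 1) * c z) + d (z - 1) -
          d (z + 1) : ℝ) : ℂ) * E z := by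
      funext z; push_cast; ring
    rw [heq] at h
    exact h
  have hzero : (fun z : ℤ => ((2 * σ * (((z : ℝ) ^ 2 * M + 1) * c z) + d (z - 1) -
      d (z + 1) : ℝ) : ℂ) * E z) = fun _ => 0 := by
    funext z; rw [hrec z]; simp
  rw [hzero] at hcomb
  have h0 := hcomb.unique hasSum_zero
  linear_combination (-(1 : ℂ) / 2) * h0

/-- Sign of `φ'(0)`: with `dₙ ≤ d₋ₙ`, `d₁ < d₋₁` and `eₙ = e₋ₙ > 0` (`n ≠ 0`), the sum
`Σ_z z μ d_z/e_z` is negative. [folklore] -/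
theorem sum_sign {d : ℤ → ℝ} {M μ L : ℝ} (hM : 4 ≤ M) (hμ : 0 < μ)
    (hsym : ∀ n : ℕ, d n ≤ d (-(n : ℤ))) (hd1 : d 1 < d (-1))
    (hL : HasSum (fun z : ℤ => (z : ℝ) * μ * (d z / (((z : ℝ) ^ 2 - 1) * M + 1))) L) :
    L < 0 := by
  have h2 := hL.nat_add_neg
  simp only [Int.cast_natCast, Int.cast_neg, Int.cast_zero, zero_mul, add_zero] at h2
  have hterm : ∀ n : ℕ, (n : ℝ) * μ * (d n / (((n : ℝ) ^ 2 - 1) * M + 1)) +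
      -(n : ℝ) * μ * (d (-(n : ℤ)) / (((-(n : ℝ)) ^ 2 - 1) * M + 1)) ≤ 0 := by
    intro n
    rcases Nat.eq_zero_or_pos n with rfl | hn
    · simp
    · have hn1 : (1 : ℝ) ≤ n := by exact_mod_cast hn
      have hn2 : (0 : ℝ) ≤ (n : ℝ) ^ 2 - 1 := by nlinarith
      have he : 0 < ((n : ℝ) ^ 2 - 1) * M + 1 := by
        have : (0 : ℝ) ≤ ((n : ℝ) ^ 2 - 1) * M := mul_nonneg hn2 (by linarith)
        linarith
      rw [neg_sq, show (n : ℝ) * μ * (d n / (((n : ℝ) ^ 2 - 1) * M + 1)) +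
          -(n : ℝ) * μ * (d (-(n : ℤ)) / ((((n : ℝ)) ^ 2 - 1) * M + 1)) =
          (n : ℝ) * μ * (d n - d (-(n : ℤ))) / (((n : ℝ) ^ 2 - 1) * M + 1) by ring]
      exact div_nonpos_of_nonpos_of_nonneg
        (mul_nonpos_of_nonneg_of_nonpos (by positivity) (sub_nonpos.2 (hsym n))) he.le
  refine hasSum_lt (f := fun n : ℕ => (n : ℝ) * μ * (d n / (((n : ℝ) ^ 2 - 1) * M + 1)) +
      -(n : ℝ) * μ * (d (-(n : ℤ)) / (((-(n : ℝ)) ^ 2 - 1) * M + 1))) (g := fun _ => 0) (i := 1)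
    hterm ?_ h2 hasSum_zero
  have hlt := mul_lt_mul_of_pos_left hd1 hμ
  norm_num
  linarith


/-! ### E. The eigenfunction `φ(y) = Σ_z c_z e^{izmy}` (FSV (5.4)) -/

/-- **Assembly of the eigenfunction.** Given `σ > 0` and a real sequence `d` on `ℤ` that satisfies
the recurrence (5.9) `d_{z+1} − d_{z−1} = a_z d_z`, `a_z = 2σ(z²m²+1)/((z²−1)m²+1)`, decays
exponentially, and has `dₙ ≤ d₋ₙ`, `d₁ < d₋₁`, the function `φ(y) = Σ_z c_z e^{izmy}` with
`c_z = d_z/((z²−1)m²+1)` ((5.8)) is real-analytic, `2π`-periodic, not identically zero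
(`φ'(0) ≠ 0`), and solves the Rayleigh equation (5.5) of `sin(my)` with `k = 1`.
[cite: FriedlanderStraussVishik1997, §5 (5.4)–(5.9), p. 207] -/
theorem exists_eigenfunction {m : ℕ} (hm : 1 < m) {σ : ℝ} {d : ℤ → ℝ}
    (hrec : ∀ z : ℤ, d (z + 1) - d (z - 1) =
      2 * σ * ((z : ℝ) ^ 2 * (m : ℝ) ^ 2 + 1) / (((z : ℝ) ^ 2 - 1) * (m : ℝ) ^ 2 + 1) * d z)
    (hdec : ∃ K ρ : ℝ, 0 ≤ K ∧ 0 < ρ ∧ ρ < 1 ∧ ∀ z : ℤ, |d z| ≤ K * ρ ^ z.natAbs)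
    (hsym : ∀ n : ℕ, d n ≤ d (-(n : ℤ))) (hd1 : d 1 < d (-1)) :
    ∃ φ : ℝ → ℂ, AnalyticOnNhd ℝ φ Set.univ ∧ Function.Periodic φ (2 * Real.pi) ∧
      (∃ y, φ y ≠ 0) ∧ IsKolmogorovRayleighSolution m 1 σ φ := by
  obtain ⟨K, ρ, hK, hρ0, hρ1, hdK⟩ := hdec
  have hm1 : (1 : ℝ) < m := by exact_mod_cast hm
  have hm2 : (2 : ℝ) ≤ m := by exact_mod_cast hm
  have hM4 : (4 : ℝ) ≤ (m : ℝ) ^ 2 := by nlinarith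
  -- the denominators e_z = (z² - 1) m² + 1 satisfy |e_z| ≥ 1
  have he : ∀ z : ℤ, 1 ≤ |((z : ℝ) ^ 2 - 1) * (m : ℝ) ^ 2 + 1| := by
    intro z
    rcases eq_or_ne z 0 with rfl | hz
    · rw [Int.cast_zero, abs_of_nonpos (by nlinarith)]
      nlinarith
    · have h1 : (1 : ℝ) ≤ |(z : ℝ)| := by exact_mod_cast Int.one_le_abs hz
      have hz1 : (1 : ℝ) ≤ (z : ℝ) ^ 2 := by nlinarith [abs_nonneg (z : ℝ), sq_abs (z : ℝ)]
      rw [abs_of_pos (by nlinarith)]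
      nlinarith
  have he0 : ∀ z : ℤ, ((z : ℝ) ^ 2 - 1) * (m : ℝ) ^ 2 + 1 ≠ 0 := fun z h => by
    have := he z
    rw [h, abs_zero] at this
    exact absurd this (by norm_num)
  -- the Fourier coefficients c_z = d_z / e_z  (FSV (5.8))
  obtain ⟨c, hc⟩ : ∃ c : ℤ → ℝ, ∀ z, c z = d z / (((z : ℝ) ^ 2 - 1) * (m : ℝ) ^ 2 + 1) :=
    ⟨_, fun z => rfl⟩
  have hc_bound : ∀ z, |c z| ≤ K * ρ ^ z.natAbs := by
    intro z
    rw [hc, abs_div]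
    exact (div_le_self (abs_nonneg _) (he z)).trans (hdK z)
  obtain ⟨δ, hδ, g, hg, hgb⟩ := decay_summable hK hρ0 hρ1 hc_bound hm1.le
  -- frequencies ν_z = z m
  obtain ⟨ν, hν⟩ : ∃ ν : ℤ → ℝ, ∀ z, ν z = (z : ℝ) * m := ⟨_, fun z => rfl⟩
  have hgb' : ∀ j : ℕ, j ≤ 2 → ∀ z,
      ‖(c z : ℂ) * ((ν z : ℂ) * I) ^ j‖ * Real.exp (|ν z| * δ) ≤ g z := by
    intro j hj z; rw [hν]; exact hgb j hj z
  have hb0 : ∀ z, ‖(c z : ℂ)‖ * Real.exp (|ν z| * δ) ≤ g z := by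
    intro z; simpa using hgb' 0 (by norm_num) z
  have hb1 : ∀ z, ‖(c z : ℂ) * (ν z * I)‖ * Real.exp (|ν z| * δ) ≤ g z := by
    intro z; simpa using hgb' 1 (by norm_num) z
  have hb2 : ∀ z, ‖(c z : ℂ) * (ν z * I) * (ν z * I)‖ * Real.exp (|ν z| * δ) ≤ g z := by
    intro z; simpa [pow_two, mul_assoc] using hgb' 2 le_rfl z
  -- the series for φ, φ', φ'' as functions on the strip |Im w| < δ
  obtain ⟨Φ₀, hΦ₀⟩ : ∃ Φ₀ : ℂ → ℂ, Φ₀ = fun w => ∑' z, (c z : ℂ) * cexp (ν z * w * I) :=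
    ⟨_, rfl⟩
  obtain ⟨Φ₁, hΦ₁⟩ : ∃ Φ₁ : ℂ → ℂ,
      Φ₁ = fun w => ∑' z, (c z : ℂ) * (ν z * I) * cexp (ν z * w * I) := ⟨_, rfl⟩
  obtain ⟨Φ₂, hΦ₂⟩ : ∃ Φ₂ : ℂ → ℂ,
      Φ₂ = fun w => ∑' z, (c z : ℂ) * (ν z * I) * (ν z * I) * cexp (ν z * w * I) := ⟨_, rfl⟩
  have hU : IsOpen {w : ℂ | |w.im| < δ} :=
    isOpen_lt (continuous_abs.comp Complex.continuous_im) continuous_const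
  have hD0 : ∀ w : ℂ, |w.im| < δ → HasDerivAt Φ₀ (Φ₁ w) w := by
    intro w hw; rw [hΦ₀, hΦ₁]; exact (strip_hasDerivAt hg hb0 hw).1
  have hD1 : ∀ w : ℂ, |w.im| < δ → HasDerivAt Φ₁ (Φ₂ w) w := by
    intro w hw; rw [hΦ₁, hΦ₂]; exact (strip_hasDerivAt hg hb1 hw).1
  have him : ∀ y : ℝ, |(y : ℂ).im| < δ := fun y => by
    rw [Complex.ofReal_im, abs_zero]; exact hδ
  -- restriction to the real line
  have hφ' : ∀ y : ℝ, HasDerivAt (fun y : ℝ => Φ₀ y) (Φ₁ y) y :=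
    fun y => (hD0 y (him y)).comp_ofReal
  have hφ'' : ∀ y : ℝ, HasDerivAt (fun y : ℝ => Φ₁ y) (Φ₂ y) y :=
    fun y => (hD1 y (him y)).comp_ofReal
  have hderiv : deriv (fun y : ℝ => Φ₀ y) = fun y : ℝ => Φ₁ y := funext fun y => (hφ' y).deriv
  have hderiv2 : ∀ y : ℝ, deriv (deriv fun y : ℝ => Φ₀ y) y = Φ₂ y := fun y => by
    rw [hderiv]; exact (hφ'' y).deriv
  refine ⟨fun y => Φ₀ y, fun y _ => ?_, fun y => ?_, ?_, ?_⟩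
  · -- real analyticity: Φ₀ is holomorphic on the strip, compose with the embedding ℝ → ℂ
    have hdiff : DifferentiableOn ℂ Φ₀ {w : ℂ | |w.im| < δ} := by
      rw [hΦ₀]; exact (strip_hasDerivAt hg hb0 (him 0)).2.1
    have hA : AnalyticAt ℂ Φ₀ (y : ℂ) := hdiff.analyticAt (hU.mem_nhds (him y))
    have hcomp := (hA.restrictScalars (𝕜 := ℝ)).comp (Complex.ofRealCLM.analyticAt y)
    have heq : (fun y : ℝ => Φ₀ y) = Φ₀ ∘ Complex.ofRealCLM := by
      funext y; simp
    rw [heq]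
    exact hcomp
  · -- 2π-periodicity
    show Φ₀ _ = Φ₀ _
    rw [hΦ₀]
    simp only [hν]
    exact tsum_periodic _ m y
  · -- φ ≢ 0 since φ'(0) = i m Σ_z z c_z ≠ 0
    by_contra hzero
    push Not at hzero
    have hconst : (fun y : ℝ => Φ₀ y) = fun _ => 0 := funext hzero
    have hd0' : HasDerivAt (fun y : ℝ => Φ₀ y) 0 0 := by
      rw [hconst]; exact hasDerivAt_const 0 0
    have hΦ₁0 : Φ₁ ((0 : ℝ) : ℂ) = 0 := (hφ' 0).unique hd0'
    -- the series of Φ₁ at 0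
    have hS := (strip_hasDerivAt hg hb1 (him 0)).2.2.hasSum
    have htsum : (∑' z, (c z : ℂ) * (ν z * I) * cexp (ν z * ((0 : ℝ) : ℂ) * I)) = 0 := by
      rw [← hΦ₁0, hΦ₁]
    rw [htsum] at hS
    simp only [Complex.ofReal_zero, mul_zero, zero_mul, Complex.exp_zero, mul_one] at hS
    -- the same series summed in ℝ
    have hreal : Summable fun z : ℤ => (z : ℝ) * m * (d z / (((z : ℝ) ^ 2 - 1) * (m : ℝ) ^ 2 + 1)) := by
      refine Summable.of_norm_bounded hg fun z => ?_
      have h1 : ‖(z : ℝ) * m * (d z / (((z : ℝ) ^ 2 - 1) * (m : ℝ) ^ 2 + 1))‖ =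
          ‖(c z : ℂ) * (ν z * I)‖ := by
        rw [hc, hν, norm_mul, Complex.norm_mul, Complex.norm_real, Complex.norm_mul,
          Complex.norm_real, Complex.norm_I, mul_one, mul_comm]
      rw [h1]
      refine le_trans ?_ (hb1 z)
      exact le_mul_of_one_le_right (norm_nonneg _) (Real.one_le_exp (by positivity))
    obtain ⟨L, hL⟩ := hreal
    have hLneg : L < 0 := sum_sign hM4 (by linarith) hsym hd1 hL
    have hLC : HasSum (fun z : ℤ => (((z : ℝ) * m * (d z / (((z : ℝ) ^ 2 - 1) * (m : ℝ) ^ 2 + 1))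
        : ℝ) : ℂ) * I) ((L : ℂ) * I) := (Complex.hasSum_ofReal.2 hL).mul_right I
    have heq : (fun z : ℤ => (((z : ℝ) * m * (d z / (((z : ℝ) ^ 2 - 1) * (m : ℝ) ^ 2 + 1))
        : ℝ) : ℂ) * I) = fun z : ℤ => (c z : ℂ) * (ν z * I) := by
      funext z; rw [hc, hν]; push_cast; ring
    rw [heq] at hLC
    have hLI : (L : ℂ) * I = 0 := hLC.unique hS
    rcases mul_eq_zero.1 hLI with h | h
    · exact absurd (Complex.ofReal_eq_zero.1 h) hLneg.ne
    · exact I_ne_zero h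
  · -- the Rayleigh equation
    refine ⟨fun y => (hφ' y).differentiableAt, ?_, fun y => ?_⟩
    · rw [hderiv]; exact fun y => (hφ'' y).differentiableAt
    simp only [Int.cast_one, mul_one, one_pow, one_mul, hderiv2]
    -- the exponentials E_z = e^{i z m y}
    obtain ⟨E, hE⟩ : ∃ E : ℤ → ℂ, ∀ z, E z = cexp (ν z * (y : ℂ) * I) := ⟨_, fun z => rfl⟩
    have hE₁ : ∀ z, E 1 * E z = E (z + 1) := by
      intro z
      rw [hE, hE, hE, ← Complex.exp_add]
      congr 1
      rw [hν, hν, hν]; push_cast; ring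
    have hEm1 : ∀ z, E (-1) * E z = E (z - 1) := by
      intro z
      rw [hE, hE, hE, ← Complex.exp_add]
      congr 1
      rw [hν, hν, hν]; push_cast; ring
    -- the series at the real point y
    have hs0 : HasSum (fun z => (c z : ℂ) * E z) (Φ₀ y) := by
      have h := (strip_hasDerivAt hg hb0 (him y)).2.2.hasSum
      have e : (∑' z, (c z : ℂ) * cexp (ν z * (y : ℂ) * I)) = Φ₀ y := by rw [hΦ₀]
      rw [e] at h
      simp only [← hE] at h
      exact h
    have hs2 : HasSum (fun z : ℤ => (c z : ℂ) * (-(((z : ℝ) ^ 2 * (m : ℝ) ^ 2 : ℝ) : ℂ)) * E z)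
        (Φ₂ y) := by
      have h := (strip_hasDerivAt hg hb2 (him y)).2.2.hasSum
      have e : (∑' z, (c z : ℂ) * (ν z * I) * (ν z * I) * cexp (ν z * (y : ℂ) * I)) = Φ₂ y := by
        rw [hΦ₂]
      rw [e] at h
      simp only [← hE] at h
      have heq : (fun z : ℤ => (c z : ℂ) * (ν z * I) * (ν z * I) * E z) =
          fun z : ℤ => (c z : ℂ) * (-(((z : ℝ) ^ 2 * (m : ℝ) ^ 2 : ℝ) : ℂ)) * E z := by
        funext z
        rw [hν]; push_cast
        linear_combination ((c z : ℂ) * (z : ℂ) ^ 2 * (m : ℂ) ^ 2 * E z) * I_mul_I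
      rw [heq] at h
      exact h
    have hd' : ∀ z : ℤ, ((z : ℝ) ^ 2 * (m : ℝ) ^ 2 + 1) * c z - (m : ℝ) ^ 2 * c z = d z := by
      intro z
      rw [show ((z : ℝ) ^ 2 * (m : ℝ) ^ 2 + 1) * c z - (m : ℝ) ^ 2 * c z =
        (((z : ℝ) ^ 2 - 1) * (m : ℝ) ^ 2 + 1) * c z by ring, hc, mul_div_cancel₀ _ (he0 z)]
    have hrec' : ∀ z : ℤ, 2 * σ * (((z : ℝ) ^ 2 * (m : ℝ) ^ 2 + 1) * c z) + d (z - 1) -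
        d (z + 1) = 0 := by
      intro z
      rw [hc]
      linear_combination (-1 : ℝ) * hrec z
    have hode := ode_algebra hs0 hs2 hd' hrec' hE₁ hEm1
    have hS : I * (Real.sin (m * y) : ℂ) = (E 1 - E (-1)) / 2 := by
      rw [I_mul_sin, hE, hE, hν, hν]
      congr 3 <;> push_cast <;> ring
    push_cast at hode
    linear_combination hode + (Φ₂ y - Φ₀ y + (m : ℂ) ^ 2 * Φ₀ y) * hS

end FriedlanderStraussVishik1997

open FriedlanderStraussVishik1997 in
/-- **Friedlander–Strauss–Vishik 1997, Proposition 5.1 (linear instability of the inviscid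
Kolmogorov flow) — discharged.** For every integer `m > 1` the Rayleigh equation of `sin(my)` has,
for the streamwise wavenumber `k = 1`, a real-analytic `2π`-periodic eigenfunction `φ ≢ 0` with a
real eigenvalue `σ > 0` (indeed `σ ∈ [1/4, 1]`). The proof follows FSV §5 (after Meshalkin–Sinai):
Fourier ansatz `φ = Σ_p c_{pm} e^{ipmy}` (5.4), three-term recurrence (5.6)/(5.9) for
`d_j = c_j(j² + k² − m²)` (5.8), its minimal solutions as infinite continued fractions
(5.14)–(5.15) with tail relation and geometric decay (5.16)–(5.18), and the characteristic equation
(5.20) solved by the intermediate value theorem (Fig. 2, (5.22)–(5.24)). As in the paper's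
construction, restricted to the modes `j ∈ mℤ` with `0 < k < m` the denominators `j² + k² − m²`
never vanish, so the Diophantine hypothesis on `m` is not used.
[cite: FriedlanderStraussVishik1997, Proposition 5.1 (p. 205), proof pp. 205–208] -/
theorem friedlanderStraussVishik1997_prop51_holds : friedlanderStraussVishik1997_prop51 := by
  intro m hm _
  have hm2 : (2 : ℝ) ≤ m := by exact_mod_cast hm
  have hM4 : (4 : ℝ) ≤ (m : ℝ) ^ 2 := by nlinarith
  -- the elements β_n = 2 w_{n+1} / e_{n+1} of the continued fractions (FSV (5.7): a_j = σ β_{j-1})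
  obtain ⟨β, hβdef⟩ : ∃ β : ℕ → ℝ, ∀ n, β n =
      2 * (((n : ℝ) + 1) ^ 2 * (m : ℝ) ^ 2 + 1) / ((((n : ℝ) + 1) ^ 2 - 1) * (m : ℝ) ^ 2 + 1) :=
    ⟨_, fun n => rfl⟩
  have hepos : ∀ n : ℕ, 0 < (((n : ℝ) + 1) ^ 2 - 1) * (m : ℝ) ^ 2 + 1 := fun n => by
    have h0 : (0 : ℝ) ≤ ((n : ℝ) + 1) ^ 2 - 1 := by nlinarith [(Nat.cast_nonneg n : (0 : ℝ) ≤ n)]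
    positivity
  have hβ : ∀ n, 2 ≤ β n := fun n => by
    rw [hβdef, le_div_iff₀ (hepos n)]
    nlinarith [(Nat.cast_nonneg n : (0 : ℝ) ≤ n)]
  have hβ0 : β 0 = 2 * ((m : ℝ) ^ 2 + 1) := by
    rw [hβdef]; norm_num
  -- the truncated continued fractions (5.14): T σ 0 n = 0, T σ (N+1) n = 1/(σ β n + T σ N (n+1))
  obtain ⟨T, hT0, hTs⟩ : ∃ T : ℝ → ℕ → ℕ → ℝ, (∀ σ n, T σ 0 n = 0) ∧
      ∀ σ N n, T σ (N + 1) n = 1 / (σ * β n + T σ N (n + 1)) :=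
    ⟨fun σ N => Nat.rec (motive := fun _ => ℕ → ℝ) (fun _ => 0)
        (fun _ ih n => 1 / (σ * β n + ih (n + 1))) N, fun _ _ => rfl, fun _ _ _ => rfl⟩
  have H : (∀ n, 2 ≤ β n) ∧ (∀ σ n, T σ 0 n = 0) ∧
      ∀ σ N n, T σ (N + 1) n = 1 / (σ * β n + T σ N (n + 1)) := ⟨hβ, hT0, hTs⟩
  -- their limits, the root σ of the characteristic equation, and the tails v = u σ
  obtain ⟨u, hu⟩ := cf_exists_limit H
  obtain ⟨σ, hσ1, -, hchar⟩ := exists_sigma H hu hM4 hβ0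
  have hσ : 0 < σ := by linarith
  have hv := cf_limit_props H hσ (hu σ hσ)
  obtain ⟨d, hd0, hd01, hpos, hneg, hsym, hd1, hdec⟩ :=
    exists_d hβ hσ (fun n => (hv n).1) (fun n => (hv n).2.1) (fun n => (hv n).2.2)
  -- the recurrence (5.9) at every integer index
  have hzero : d (0 + 1) - d (0 - 1) =
      2 * σ * ((0 : ℝ) ^ 2 * (m : ℝ) ^ 2 + 1) / (((0 : ℝ) ^ 2 - 1) * (m : ℝ) ^ 2 + 1) * d 0 := by
    rw [zero_add, zero_sub, hd01, hd0, hchar,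
      show ((0 : ℝ) ^ 2 - 1) * (m : ℝ) ^ 2 + 1 = -((m : ℝ) ^ 2 - 1) by ring, div_neg]
    ring
  have hrec : ∀ z : ℤ, d (z + 1) - d (z - 1) =
      2 * σ * ((z : ℝ) ^ 2 * (m : ℝ) ^ 2 + 1) / (((z : ℝ) ^ 2 - 1) * (m : ℝ) ^ 2 + 1) * d z := by
    intro z
    obtain ⟨n, rfl | rfl⟩ := z.eq_nat_or_neg
    · cases n with
      | zero => push_cast; exact hzero
      | succ n =>
        push_cast
        rw [show (n : ℤ) + 1 + 1 = n + 2 by ring, show (n : ℤ) + 1 - 1 = n by ring, hpos n, hβdef]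
        ring
    · cases n with
      | zero => push_cast; rw [neg_zero]; exact hzero
      | succ n =>
        push_cast
        rw [show -((n : ℤ) + 1) + 1 = -(n : ℤ) by ring, show -((n : ℤ) + 1) - 1 = -(n : ℤ) - 2 by ring,
          show -((n : ℤ) + 1) = -(n : ℤ) - 1 by ring, hneg n, hβdef]
        ring
  obtain ⟨φ, h1, h2, h3, h4⟩ := exists_eigenfunction hm hrec hdec hsym hd1
  exact ⟨1, σ, φ, one_ne_zero, hσ, h1, h2, h3, h4⟩

end Literature.Analysis.FluidPDE

end
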